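import Summits.RiemannHypothesis.RiemannHypothesis.Theorems.EtaLeadingQuarterWeakLockingLayerZeroSideMid
import HarnessLib

/-!
# The second moment of the sharp eta vector at the zeros, zero side IV: the high bands
(route EtaLeadingQuarter, item `EtaLeadingSecondMoment`, stmt-RiemannHypothesis-21791)

For a real Dirichlet polynomial `D_a(t) = ∑_{k ≤ M} a_k k^{-it}` (tree `ZeroSide.dirPoly`) and a height
`X₀ ≥ 2516`, the zeros of `ζ` above `X₀` (both signs, with multiplicity) contribute
`∑_{|γ| > X₀} m(ρ) γ^{-2} ‖D_a(γ)‖² ≤ 432 A (1 + log X₀) (X₀ + M) X₀^{-2} (3/2 + (log M)²/2) ∑ a_k²`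
(`highBands_le`; `A` is the local zero density, `N(t+1) − N(t) ≤ A log(t+2)`, tree
`Montgomery.exists_zetaZeroCount_add_one_sub_le`). Proof: dyadic blocks `(2^j X₀, 2^{j+1} X₀]`, each
bounded by the tree's `ZeroSide.midRange_le` (Gallagher cells + local count + mean values), summed
with `∑ (j+2)/2^j = 6`, and the far tail `ZeroSide.tail_le → 0`. For the eta vector
(`∑ a_k² = H_M ≤ 1 + log M`) and `X₀ = T₂ = M (log M)^5` this is `O(M^{-1} (log M)^{-1})`, so the
zeros above `T₂` do not contribute to `M · Z_M` at leading order. RH-free; nothing here bears on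
the truth of RH.
-/

noncomputable section

open Real Finset Filter Topology

set_option linter.dupNamespace false  -- the mandated namespace repeats `RiemannHypothesis`

namespace Summit.RiemannHypothesis.RiemannHypothesis.Theorems.EtaLeadingQuarter.Zeros

open Literature.NumberTheory.LFunctions NicolasJExplicit SchoenfeldBound ZeroSide

/-- `∑_{j<J} (j+2)/2^j ≤ 6` (`∑ j/2^j = 2`, `∑ 2/2^j = 4`). [folklore] -/
theorem sum_range_add_two_div_two_pow_le (J : ℕ) :
    ∑ j ∈ Finset.range J, ((j : ℝ) + 2) / 2 ^ j ≤ 6 := by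
  have h1 : HasSum (fun n : ℕ ↦ (n : ℝ) * (1 / 2) ^ n) 2 := by
    have h := hasSum_coe_mul_geometric_of_norm_lt_one (𝕜 := ℝ) (r := 1 / 2) (by norm_num)
    norm_num at h
    exact h
  have h2 : HasSum (fun n : ℕ ↦ 2 * ((1 : ℝ) / 2) ^ n) 4 := by
    have := hasSum_geometric_two.mul_left 2
    norm_num at this ⊢
    exact this
  have h := h1.add h2
  have e : ∀ j : ℕ, ((j : ℝ) + 2) / 2 ^ j = (j : ℝ) * (1 / 2) ^ j + 2 * ((1 : ℝ) / 2) ^ j := by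
    intro j
    rw [one_div_pow, add_div]
    ring
  simp_rw [e]
  refine (sum_le_hasSum _ (fun j _ ↦ by positivity) h).trans (by norm_num)

/-- The block sums are differences of the partial sums `F(T) = ∑_{|γ| ≤ T} m γ^{-2} ‖D(γ)‖²`. [folklore] -/
theorem sum_sdiff_eq_sub (a : ℕ → ℝ) (M : ℕ) {T₁ T₂ : ℝ} (h : T₁ ≤ T₂) :
    ∑ ρ ∈ zerosUpTo T₂ \ zerosUpTo T₁,
        (riemannZetaZeroOrder (ρ : ℂ) : ℝ) / (ρ : ℂ).im ^ 2 * ‖dirPoly a M (ρ : ℂ).im‖ ^ 2 =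
      ∑ ρ ∈ zerosUpTo T₂, (riemannZetaZeroOrder (ρ : ℂ) : ℝ) / (ρ : ℂ).im ^ 2 * ‖dirPoly a M (ρ : ℂ).im‖ ^ 2 -
      ∑ ρ ∈ zerosUpTo T₁, (riemannZetaZeroOrder (ρ : ℂ) : ℝ) / (ρ : ℂ).im ^ 2 * ‖dirPoly a M (ρ : ℂ).im‖ ^ 2 :=
  Finset.sum_sdiff_eq_sub (zerosUpTo_subset h)

/-- **The tail from `X₀` equals the blocks up to `T` plus the tail from `T`** (`X₀ ≤ T`). [folklore] -/
theorem tail_eq_sum_add_tail (a : ℕ → ℝ) (M : ℕ) {X₀ T : ℝ} (h : X₀ ≤ T) :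
    ∑' ρ : Zeros, (if ρ ∈ zerosUpTo X₀ then 0 else
        (riemannZetaZeroOrder (ρ : ℂ) : ℝ) / (ρ : ℂ).im ^ 2 * ‖dirPoly a M (ρ : ℂ).im‖ ^ 2) =
      ∑ ρ ∈ zerosUpTo T \ zerosUpTo X₀,
          (riemannZetaZeroOrder (ρ : ℂ) : ℝ) / (ρ : ℂ).im ^ 2 * ‖dirPoly a M (ρ : ℂ).im‖ ^ 2 +
        ∑' ρ : Zeros, (if ρ ∈ zerosUpTo T then 0 else
          (riemannZetaZeroOrder (ρ : ℂ) : ℝ) / (ρ : ℂ).im ^ 2 * ‖dirPoly a M (ρ : ℂ).im‖ ^ 2) := by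
  have h1 := tsum_eq_sum_add_tail a M X₀
  have h2 := tsum_eq_sum_add_tail a M T
  rw [sum_sdiff_eq_sub a M h]
  linarith

/-- **One dyadic block.** For `X₀ ≥ 2516`, `M`, real `a` and the local density constant `A`:
`∑_{2^j X₀ < |γ| ≤ 2^{j+1} X₀} m γ^{-2} ‖D(γ)‖² ≤ 72 A (1 + log X₀)(X₀ + M) K (j+2)/(2^j X₀²)`,
`K = (3/2 + (log M)²/2) ∑ a_k²` (tree `ZeroSide.midRange_le`). [folklore] -/
theorem block_le {A : ℝ} (hA0 : 0 ≤ A)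
    (hA : ∀ t : ℝ, 0 ≤ t → (zetaZeroCount (t + 1) : ℝ) - zetaZeroCount t ≤ A * Real.log (t + 2))
    (a : ℕ → ℝ) (M : ℕ) {X₀ : ℝ} (hX₀ : 2516 ≤ X₀) (j : ℕ) :
    ∑ ρ ∈ zerosUpTo (2 ^ (j + 1) * X₀) \ zerosUpTo (2 ^ j * X₀),
        (riemannZetaZeroOrder (ρ : ℂ) : ℝ) / (ρ : ℂ).im ^ 2 * ‖dirPoly a M (ρ : ℂ).im‖ ^ 2 ≤
      72 * A * (1 + Real.log X₀) * (X₀ + M) *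
        ((3 / 2 + Real.log M ^ 2 / 2) * ∑ k ∈ Finset.Icc 1 M, a k ^ 2) * (((j : ℝ) + 2) / (2 ^ j * X₀ ^ 2)) := by
  set K : ℝ := (3 / 2 + Real.log M ^ 2 / 2) * ∑ k ∈ Finset.Icc 1 M, a k ^ 2 with hK
  have hK0 : 0 ≤ K := by positivity
  have h2j : (1 : ℝ) ≤ 2 ^ j := one_le_pow₀ (by norm_num)
  have hX : 2 ≤ 2 ^ j * X₀ := by nlinarith
  have hXT : 2 ^ j * X₀ ≤ 2 ^ (j + 1) * X₀ := by rw [pow_succ]; nlinarith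
  have h := midRange_le hA0 hA a M hX hXT
  rw [← hK] at h
  refine h.trans ?_
  have hM0 : (0 : ℝ) ≤ M := Nat.cast_nonneg M
  have hL0 : 0 ≤ Real.log X₀ := Real.log_nonneg (by linarith)
  -- `log(2^{j+1} X₀ + 4) ≤ (j+2)(1 + log X₀)`
  have hlog : Real.log (2 ^ (j + 1) * X₀ + 4) ≤ ((j : ℝ) + 2) * (1 + Real.log X₀) := by
    have h4 : 2 ^ (j + 1) * X₀ + 4 ≤ 2 ^ (j + 2) * X₀ := by
      rw [pow_succ 2 (j + 1)]; nlinarith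
    have hpos : 0 < 2 ^ (j + 1) * X₀ + 4 := by positivity
    calc Real.log (2 ^ (j + 1) * X₀ + 4) ≤ Real.log (2 ^ (j + 2) * X₀) := Real.log_le_log hpos h4
      _ = (j + 2 : ℕ) * Real.log 2 + Real.log X₀ := by
          rw [Real.log_mul (by positivity) (by linarith), Real.log_pow]
      _ ≤ ((j : ℝ) + 2) * 1 + Real.log X₀ := by
          push_cast
          nlinarith [Real.log_two_lt_d9, Real.log_two_gt_d9]
      _ ≤ ((j : ℝ) + 2) * (1 + Real.log X₀) := by nlinarith
  -- `5(2^{j+1}X₀ + 1) + 18M ≤ 18 · 2^j (X₀ + M)`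
  have hlen : 5 * (2 ^ (j + 1) * X₀ + 1) + 18 * (M : ℝ) ≤ 18 * 2 ^ j * (X₀ + M) := by
    rw [pow_succ]; nlinarith
  have hlog0 : 0 ≤ Real.log (2 ^ (j + 1) * X₀ + 4) := Real.log_nonneg (by nlinarith)
  calc 2 * ((2 ^ j * X₀) ^ 2)⁻¹ * (2 * A * Real.log (2 ^ (j + 1) * X₀ + 4)) *
        ((5 * (2 ^ (j + 1) * X₀ + 1) + 18 * M) * K)
      ≤ 2 * ((2 ^ j * X₀) ^ 2)⁻¹ * (2 * A * (((j : ℝ) + 2) * (1 + Real.log X₀))) *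
        ((18 * 2 ^ j * (X₀ + M)) * K) := by
        gcongr
    _ = 72 * A * (1 + Real.log X₀) * (X₀ + M) * K * (((j : ℝ) + 2) / (2 ^ j * X₀ ^ 2)) := by
        field_simp
        ring

/-- The blocks telescope: `∑_{j<J} (block j) = F(2^J X₀) − F(X₀)`. [folklore] -/
theorem sum_blocks_eq (a : ℕ → ℝ) (M : ℕ) {X₀ : ℝ} (hX₀ : 0 ≤ X₀) (J : ℕ) :
    ∑ j ∈ Finset.range J, ∑ ρ ∈ zerosUpTo (2 ^ (j + 1) * X₀) \ zerosUpTo (2 ^ j * X₀),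
        (riemannZetaZeroOrder (ρ : ℂ) : ℝ) / (ρ : ℂ).im ^ 2 * ‖dirPoly a M (ρ : ℂ).im‖ ^ 2 =
      ∑ ρ ∈ zerosUpTo (2 ^ J * X₀) \ zerosUpTo X₀,
        (riemannZetaZeroOrder (ρ : ℂ) : ℝ) / (ρ : ℂ).im ^ 2 * ‖dirPoly a M (ρ : ℂ).im‖ ^ 2 := by
  have hmono : ∀ j : ℕ, 2 ^ j * X₀ ≤ 2 ^ (j + 1) * X₀ := fun j ↦ by
    rw [pow_succ]; nlinarith [one_le_pow₀ (show (1 : ℝ) ≤ 2 by norm_num) (n := j)]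
  have h1 : (1 : ℝ) * X₀ ≤ 2 ^ J * X₀ := by nlinarith [one_le_pow₀ (show (1 : ℝ) ≤ 2 by norm_num) (n := J)]
  rw [sum_sdiff_eq_sub a M (by simpa using h1)]
  simp_rw [sum_sdiff_eq_sub a M (hmono _)]
  rw [Finset.sum_range_sub (fun j ↦ ∑ ρ ∈ zerosUpTo (2 ^ j * X₀),
    (riemannZetaZeroOrder (ρ : ℂ) : ℝ) / (ρ : ℂ).im ^ 2 * ‖dirPoly a M (ρ : ℂ).im‖ ^ 2)]
  simp

/-- **The high bands.** For `X₀ ≥ 2516`, real `a`, `M`, and the local density constant `A`: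
`∑_{|γ| > X₀} m(ρ) γ^{-2} ‖D_a(γ)‖² ≤ 432 A (1 + log X₀)(X₀ + M) X₀^{-2} · (3/2 + (log M)²/2) ∑ a_k²`.
[folklore] -/
theorem highBands_le {A : ℝ} (hA0 : 0 ≤ A)
    (hA : ∀ t : ℝ, 0 ≤ t → (zetaZeroCount (t + 1) : ℝ) - zetaZeroCount t ≤ A * Real.log (t + 2))
    (a : ℕ → ℝ) (M : ℕ) {X₀ : ℝ} (hX₀ : 2516 ≤ X₀) :
    ∑' ρ : Zeros, (if ρ ∈ zerosUpTo X₀ then 0 else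
        (riemannZetaZeroOrder (ρ : ℂ) : ℝ) / (ρ : ℂ).im ^ 2 * ‖dirPoly a M (ρ : ℂ).im‖ ^ 2) ≤
      432 * A * (1 + Real.log X₀) * (X₀ + M) / X₀ ^ 2 *
        ((3 / 2 + Real.log M ^ 2 / 2) * ∑ k ∈ Finset.Icc 1 M, a k ^ 2) := by
  set K : ℝ := (3 / 2 + Real.log M ^ 2 / 2) * ∑ k ∈ Finset.Icc 1 M, a k ^ 2 with hK
  set f : Zeros → ℝ := fun ρ ↦
    (riemannZetaZeroOrder (ρ : ℂ) : ℝ) / (ρ : ℂ).im ^ 2 * ‖dirPoly a M (ρ : ℂ).im‖ ^ 2 with hf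
  set B : ℝ := 432 * A * (1 + Real.log X₀) * (X₀ + M) / X₀ ^ 2 * K with hB
  set S₁ : ℝ := (∑ k ∈ Finset.Icc 1 M, |a k|) ^ 2 with hS₁
  have hX0 : 0 < X₀ := by linarith
  have hK0 : 0 ≤ K := by positivity
  have hL0 : 0 ≤ Real.log X₀ := Real.log_nonneg (by linarith)
  have hM0 : (0 : ℝ) ≤ M := Nat.cast_nonneg M
  -- for every `J`: tail(X₀) ≤ B + S₁ · 0.34 log(2^J X₀)/(2^J X₀)
  have hJ : ∀ J : ℕ, ∑' ρ : Zeros, (if ρ ∈ zerosUpTo X₀ then 0 else f ρ) ≤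
      B + S₁ * (0.34 * Real.log (2 ^ J * X₀) / (2 ^ J * X₀)) := by
    intro J
    have h2J : (1 : ℝ) ≤ 2 ^ J := one_le_pow₀ (by norm_num)
    have hT : X₀ ≤ 2 ^ J * X₀ := by nlinarith
    have hT' : 2516 ≤ 2 ^ J * X₀ := hX₀.trans hT
    rw [tail_eq_sum_add_tail a M hT, ← sum_blocks_eq a M hX0.le J]
    have hblocks : ∑ j ∈ Finset.range J, ∑ ρ ∈ zerosUpTo (2 ^ (j + 1) * X₀) \ zerosUpTo (2 ^ j * X₀), f ρ ≤ B := by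
      calc ∑ j ∈ Finset.range J, ∑ ρ ∈ zerosUpTo (2 ^ (j + 1) * X₀) \ zerosUpTo (2 ^ j * X₀), f ρ
          ≤ ∑ j ∈ Finset.range J, 72 * A * (1 + Real.log X₀) * (X₀ + M) * K * (((j : ℝ) + 2) / (2 ^ j * X₀ ^ 2)) :=
            Finset.sum_le_sum fun j _ ↦ block_le hA0 hA a M hX₀ j
        _ = 72 * A * (1 + Real.log X₀) * (X₀ + M) * K / X₀ ^ 2 *
              ∑ j ∈ Finset.range J, ((j : ℝ) + 2) / 2 ^ j := by
            rw [Finset.mul_sum]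
            refine Finset.sum_congr rfl fun j _ ↦ ?_
            field_simp
        _ ≤ 72 * A * (1 + Real.log X₀) * (X₀ + M) * K / X₀ ^ 2 * 6 :=
            mul_le_mul_of_nonneg_left (sum_range_add_two_div_two_pow_le J) (by positivity)
        _ = B := by rw [hB]; ring
    have htail := tail_le a M hT'
    linarith
  -- the far tail tends to `0`
  have hlim : Tendsto (fun J : ℕ ↦ B + S₁ * (0.34 * Real.log (2 ^ J * X₀) / (2 ^ J * X₀))) atTop (𝓝 (B + S₁ * 0)) := by
    refine tendsto_const_nhds.add (tendsto_const_nhds.mul ?_)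
    have h1 : Tendsto (fun x : ℝ ↦ Real.log x ^ 1 / (1 * x + 0)) atTop (𝓝 0) :=
      Real.tendsto_pow_log_div_mul_add_atTop 1 0 1 one_ne_zero
    have h2 : Tendsto (fun J : ℕ ↦ (2 : ℝ) ^ J * X₀) atTop atTop :=
      (tendsto_pow_atTop_atTop_of_one_lt (by norm_num : (1 : ℝ) < 2)).atTop_mul_const hX0
    have h3 := (h1.comp h2).const_mul 0.34
    rw [mul_zero] at h3
    refine h3.congr fun J ↦ ?_
    simp only [Function.comp, pow_one, one_mul, add_zero]
    ring
  rw [mul_zero, add_zero] at hlim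
  exact ge_of_tendsto' hlim hJ

end Summit.RiemannHypothesis.RiemannHypothesis.Theorems.EtaLeadingQuarter.Zeros

end
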